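import Summits.QuantumFields.YangMills.Theorems.BalabanUVNodesN24ChildrenSplitN07N11N13Suppliers
import Summits.QuantumFields.YangMills.Theorems.BalabanUVNodesN11Sect3SupplyChainNodeAtNumerics

/-!
# DAG node N11 — THE SPLIT CLOSERS' TYPE `h11` ∕ THE WORLD-FREE FAMILY `h11F` AT K1's WITNESS OF RECORD, SUPPLIED BY NAME FROM THE DOOR PROVISOS AND N11's ONE-TOKEN
# RESIDUAL `SupplyChainAt` (laws reading), FROM A SUPPLIER PER RUN THROUGH [III]'s THEOREM OF p. 245 AS PRINTED, AND FROM A SUPPLIER WITH THE ROWS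

Cell `pub-ymgap`, YM-PLAN Track A (HUMAN RULING D-0062 ∕ D-0149 ∕ D-0154), seat `pub-ymgap-dag-n11-w5` (g0; WIDTH SEAT 5 on node N11 [B14]; dag-n11-e g19's hand-out «X5»,
INBOX l.29059), route `BalabanUVNodes` rev 25, item K1⁷ `StabilityBAtRecordR13SepCoPH` = stmt-QuantumFields-20542 (helper lane `--supports … --as helper`, count-neutral).
[III] = [Balaban1988Convergent], [IV] = [Balaban1989LargeFieldI], [B16] = [Balaban1989LargeFieldII].

WHY THIS FILE.  dag-n24-c's split closers of K1⁷ (Parts 23 ∕ 26 ∕ 27 `…N24K1OfOpenStubsV19ChildrenSplitByName`, Part 29 `…N24K1ByNameOfOpenStubs…`) key NODE N11 at the witness of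
record `θᴴ := Stage13HParams.ofHistoryBlind F N ⟨θ₁₅ᶜᶜᴹᵂ, ZrOfRecord₁₃ F N θ₁₅ᶜᶜᴹᵂ⟩`, `θ₁₅ᶜᶜᴹᵂ = theta13OfThm1CCMW F N j γ ε₀ ε₂₉ B₃ B₃' a₀ a₁`, on the world-free FAMILY
`h11F : ∀ (door letters and hypotheses), ∀ βup β₀, ∃ γ₁₁ > 0, ∀ w bound to the door's datum, …, ∀ P, b7 → … → flowControl → ∀ k < P.K, SLaw₁₃CoPH θᴴ P k → TLaw₁₃CoPH θᴴ P k`.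
Part 28 (34H, p606032) `N24_h11_theta13OfThm1CCMW_of_thmP245_laws` reduces ONE member of that family to the binder `hT : ∀ P k, k < P.K → SLaw → TLaw` ([III]'s Theorem of
p. 245 in the sequence reading), and dag-n11-e g19 (p606248 §3b) supplies THAT binder from `hrec : θᴴ.Provisos₁₃CoPH` and N11's one-token residual `∀ P, SupplyChainAt θᴴ P`
(`∃ σ, SupplierObligations θᴴ P σ ∧ NoExpansionObligation θᴴ P σ` — [III] §3's supplier and dag-n11-d's no-expansion clause).  THIS FILE composes the two BY NAME, `hrec` being the
`.toCore` of dag-n24-c's door provisos `N24_provisos₁₃SepCoPH_door_theta13OfThm1CCMW_of_gauge9TopStepR_of_betaBoxSignFree_allTorus`, so that: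
§1 (laws reading) `h11_…_of_supplyChainAt`: at fixed door letters the TYPE `h11` ⟸ `∀ P, SupplyChainAt θᴴ P` — NOTHING ELSE; ★ `h11F_…_of_supplyChainAt`: the FAMILY `h11F` VERBATIM
   (general `N`; Parts 27∕29 read it at `N = 2`) ⟸ the family `∀ (door letters and hypotheses), ∀ P, SupplyChainAt θᴴ P`.
§2 (AS PRINTED) `h11_…_of_thmP245PrintedI_of_obligations`: the TYPE `h11` through Part 28 §2's AS-PRINTED door `N24_h11_theta13OfThm1CCMW_of_thmP245PrintedI` — for any family
   `T P k` of renormalization transformations agreeing with the tower of record on the trajectory, [III]'s sentence `B14.ThmP245PrintedI (T P) ρ S Scorr P.K` is dag-n11-e's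
   `thmP245PrintedI_theta13OfThm1CCMWH_of_obligations` from a supplier per run with its obligations and the no-expansion obligation.
§3 (rows) `h11_…_of_obligations_of_rows` (+ family `h11F_…_of_obligations_of_rows`): the TYPE from a supplier per run with `SupplierObligations`, the witness-free
   `ResidualRows` and def-T's `OperandRowsAlongChain` — the guard `θᴴ.ZhUnity` DISCHARGED in the kernel by def-T's `Stage13RParams.ZrUnity.ofHistoryBlind` over dag-n11-d's
   partition of unity `finsum_ζ0_ZrOfRecord₁₃` (dag-n24-c's door convention), NOT displayed.

LOCATED-ZH (dag-n11-e g19, INBOX l.29059, verbatim in substance).  At the bare `θᴴ = ofHistoryBlind ⟨θ₁₅ᶜᶜᴹᵂ, ZrOfRecord₁₃ …⟩` the history-indexed slot is `Zh p n Ω Λ := ZrOfRecord₁₃ … p`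
— HISTORY-BLIND (node00-def-K0a's all-large-diagonal pin; NOT in the `ZhPin` class: `ZhPinOfRecord₁₃`'s `ζ0` differs at every off-diagonal no-expansion history; dag-n11-d
p538518 `not_exists_historyBlind_pointwise_pin`: off the diagonal no history-blind value can serve; director-ym №183 ∕ №186 made the slot history-indexed for exactly this).  So the
`NoExpansionObligation` half of `SupplyChainAt θᴴ P` — hence `h11F` at THAT `θᴴ` — is what NO N11 lane discharges; the tree discharges it in the `ZhPin` class: at dag-n11-w1's
`gaussPinH θᴴ` (no-expansion half ⟸ def-T's operand rows alone, p606248 §3c; dag-n11-w6's hand-out «X6» builds the K1 witness's N11 side there) or at dag-n11-d's `rePinH θᴴ`.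
This file DISPLAYS `∀ P, SupplyChainAt θᴴ P` (§1), the supplier's obligations + no-expansion obligation (§2) and the rows (§3) at the bare `θᴴ` exactly as the split closers
key them; it never discharges them, and it makes NO claim that they are inhabited there (A6: LOCATED, not a discharge).

HONEST FRAMING.  Count-neutral kernel composition BY NAME (each proof ONE application of p606032 over p606248); `SupplierObligations` ([III] §3 ∕ Thm 2 — nobody's theorem yet),
`NoExpansionObligation`, `ResidualRows`, `OperandRowsAlongChain` and the door's K0-side hypotheses (`h15`, `h9`, the sign-free β-box) are DISPLAYED, never discharged; nothing of
Bałaban asserted; N11 NOT discharged; K1⁷ NOT closed, no stub closed; counts unmoved (typed 28∕28 · discharged 5∕27).  One finite `𝕋⁴_{L^K}` programme at fixed `ε = L^{−K}`;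
R4 closes only the conditional finite-𝕋⁴ rung `BalabanLadder.UV` — NOT ℝ⁴, NOT OS, NOT a mass gap, NOT Clay; no summit statement is proved by this seat.  No `sorry`, `axiom`,
`def`, `instance`, `notation`.  General `N` throughout (STANDING PRACTICE «general-N where free»; `N = 2` by instantiation).
Sources (bookkeeping only): [III] Theorem p.245, Thm 1 p.262, remark p.262, §3 p.279, (3.24)–(3.25) p.270, (3.16)–(3.22) pp.268–269, (2.4)–(2.6) p.255; [IV] (0.2)–(0.4) p.176;
[B16] Thm 1 p.355; [Balaban1987RG1] Thm 1 p.259; [Balaban1985Variational] Thm 1 (8)–(9) p.279, Prop. 8 p.304.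
-/

noncomputable section

open scoped Matrix.Norms.L2Operator BigOperators

namespace Summit.QuantumFields.YangMills.Theorems.BalabanUVNodesN11H11TypeOfSupplyChain

open Literature.MathematicalPhysics.QuantumFieldTheory.Balaban1983to89
open Literature.MathematicalPhysics.QuantumFieldTheory.Balaban1983to89.Node00
open DagBinding T4Continuum T4DatumAssembly FlowStepRuns AveragingRT
open FlowStep (BetaLowerH BetaUpperH)
open Summit.QuantumFields.YangMills.BalabanUVNodes.N24ChildrenSplitN07N11N13Suppliers
  (N24_h11_theta13OfThm1CCMW_of_thmP245_laws N24_h11_theta13OfThm1CCMW_of_thmP245PrintedI)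
open BalabanUVNodesN11Sect3SupplyChainDefs (Sect3Supplier)
open BalabanUVNodesN11Sect3SupplyChainObligationsDefs (SupplierObligations NoExpansionObligation SupplyChainAt ResidualRows OperandRowsAlongChain)
open BalabanUVNodesN11Sect3SupplyChainNodeAtNumerics
  (thmP245Laws_all_ofHistoryBlind_theta13OfThm1CCMW_of_supplyChainAt thmP245Laws_all_ofHistoryBlind_theta13OfThm1CCMW_of_obligations_of_rows
   thmP245PrintedI_theta13OfThm1CCMWH_of_obligations)

variable {F : T4Family} {N : ℕ} [NeZero N]

/-! ## §1  Laws reading: the TYPE `h11` and the FAMILY `h11F` from the door provisos and `∀ P, SupplyChainAt θᴴ P` — nothing else -/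

/-- **★★ THE SPLIT CLOSERS' TYPE `h11` AT K1's WITNESS OF RECORD (door letters fixed) FROM N11's ONE-TOKEN RESIDUAL `∀ P, SupplyChainAt θᴴ P` — NOTHING ELSE**: at
`θᴴ := Stage13HParams.ofHistoryBlind F N ⟨θ₁₅ᶜᶜᴹᵂ, ZrOfRecord₁₃ F N θ₁₅ᶜᶜᴹᵂ⟩`, dag-n24-c 34H §1 `N24_h11_theta13OfThm1CCMW_of_thmP245_laws` with its binder `hT` ([III]'s Theorem of p. 245 in the
sequence reading) supplied BY NAME by dag-n11-e's `thmP245Laws_all_ofHistoryBlind_theta13OfThm1CCMW_of_supplyChainAt` from `hrec := (door provisos).toCore` and `hN`.  LOCATED-ZH: at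
this bare history-blind `θᴴ` the `NoExpansionObligation` conjunct inside `SupplyChainAt θᴴ P` is discharged by NO lane (the tree discharges it in the `ZhPin` class, `gaussPinH` ∕
`rePinH`); displayed, not claimed inhabited.  CONDITIONAL; N11 NOT discharged; K1⁷ NOT closed.
[cite: Balaban1988Convergent, Theorem p.245, Thm 1 p.262, remark p.262, §3 p.279, (2.4)–(2.6) p.255; Balaban1987RG1, Thm 1 p.259; Balaban1989LargeFieldI, (0.2)–(0.4) p.176; Balaban1989LargeFieldII, Thm 1 p.355 (bookkeeping)] -/
theorem h11_ofHistoryBlind_theta13OfThm1CCMW_of_supplyChainAt {j c : ℕ} {γ ε₀ ε₂₉ B₃ B₃' a₀ a₁ : ℝ} (hγ₀ : 0 < γ) (hγh : γ ≤ 1 / 2)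
    (hε : 0 < ε₀) (hε' : 0 < ε₂₉) (hB : 0 ≤ B₃) (hB' : 0 ≤ B₃') (ha₀ : 0 < a₀) (ha₁ : 0 < a₁)
    (h15 : VariationalThm1RegSepCoP7M F N B₃ a₀ a₁) (hc : c ≤ F.L ^ j)
    (h9 : Gauge9RegSepTopStepR F N (fun ν K Ω => suppDomOfRecord F ν K Ω) (F.L ^ j) c B₃ B₃' a₀ a₁)
    {bl β' : ℝ} (hbox : BetaLowerH bl γ (betaOfRecord₁₃ F N (theta13OfThm1CCMW F N j γ ε₀ ε₂₉ B₃ B₃' a₀ a₁)))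
    (hbox' : BetaUpperH β' γ (betaOfRecord₁₃ F N (theta13OfThm1CCMW F N j γ ε₀ ε₂₉ B₃ B₃' a₀ a₁))) (hl : -bl * γ ^ 2 ≤ 3) (hβ' : β' * γ ^ 2 ≤ 3 / 4)
    (hN : ∀ P : B12.RunParams, SupplyChainAt (Stage13HParams.ofHistoryBlind F N ⟨theta13OfThm1CCMW F N j γ ε₀ ε₂₉ B₃ B₃' a₀ a₁, ZrOfRecord₁₃ F N (theta13OfThm1CCMW F N j γ ε₀ ε₂₉ B₃ B₃' a₀ a₁)⟩) P) :
    ∀ βup β₀ : ℝ, ∃ γ₁₁ : ℝ, 0 < γ₁₁ ∧ ∀ w : WorldP, w.C = (datumOfRecord₁₃SepCoPH F N (Stage13HParams.ofHistoryBlind F N ⟨theta13OfThm1CCMW F N j γ ε₀ ε₂₉ B₃ B₃' a₀ a₁, ZrOfRecord₁₃ F N (theta13OfThm1CCMW F N j γ ε₀ ε₂₉ B₃ B₃' a₀ a₁)⟩) (N24_provisos₁₃SepCoPH_door_theta13OfThm1CCMW_of_gauge9TopStepR_of_betaBoxSignFree_allTorus hγ₀ hγh hε hε' hB hB' ha₀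 ha₁ h15 hc h9 hbox hbox' hl hβ')).C →
      w.βup = βup → w.β₀ = β₀ → w.γ ≤ γ₁₁ → ∀ P : B12.RunParams, (leavesP w P).b7 → (leavesP w P).b8 → (leavesP w P).b9 → (leavesP w P).b10 → (leavesP w P).b11 →
      (leavesP w P).smallCouplings → (leavesP w P).smallFieldInductive → (leavesP w P).flowControl →
        ∀ k, k < P.K → SLaw₁₃CoPH F N (Stage13HParams.ofHistoryBlind F N ⟨theta13OfThm1CCMW F N j γ ε₀ ε₂₉ B₃ B₃' a₀ a₁, ZrOfRecord₁₃ F N (theta13OfThm1CCMW F N j γ ε₀ ε₂₉ B₃ B₃' a₀ a₁)⟩) P k → TLaw₁₃CoPH F N (Stage13HParams.ofHistoryBlind F N ⟨theta13OfThm1CCMW F N j γ ε₀ ε₂₉ B₃ B₃' a₀ a₁, ZrOfRecord₁₃ F N (theta13OfThm1CCMW F N j γ ε₀ ε₂₉ B₃ B₃' a₀ a₁)⟩) P k :=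
  N24_h11_theta13OfThm1CCMW_of_thmP245_laws hγ₀ hγh hε hε' hB hB' ha₀ ha₁ h15 hc h9 hbox hbox' hl hβ'
    (thmP245Laws_all_ofHistoryBlind_theta13OfThm1CCMW_of_supplyChainAt (ZrOfRecord₁₃ F N (theta13OfThm1CCMW F N j γ ε₀ ε₂₉ B₃ B₃' a₀ a₁)) hγ₀ hγh hε hε' hB hB' ha₀ ha₁
      (N24_provisos₁₃SepCoPH_door_theta13OfThm1CCMW_of_gauge9TopStepR_of_betaBoxSignFree_allTorus hγ₀ hγh hε hε' hB hB' ha₀ ha₁ h15 hc h9 hbox hbox' hl hβ').toCore hN)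

/-- **★★★ THE SPLIT CLOSERS' WORLD-FREE FAMILY `h11F` VERBATIM (dag-n24-c Parts 27∕29's binder; general `N`, read there at `N = 2`) FROM THE FAMILY OF N11's ONE-TOKEN RESIDUALS
`hNF : ∀ (door letters and hypotheses), ∀ P, SupplyChainAt θᴴ P`** — §1's `h11_ofHistoryBlind_theta13OfThm1CCMW_of_supplyChainAt` under the binders; the supplier family `hNF` is
offered every door letter and hypothesis the closers quantify over (a supplier blind to some of them ignores them).  LOCATED-ZH as in §1's first theorem: displayed, not claimed
inhabited at the bare history-blind `θᴴ`.  CONDITIONAL; N11 NOT discharged; K1⁷ NOT closed.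
[cite: Balaban1988Convergent, Theorem p.245, Thm 1 p.262, remark p.262, §3 p.279, (2.4)–(2.6) p.255; Balaban1987RG1, Thm 1 p.259; Balaban1989LargeFieldI, (0.2)–(0.4) p.176; Balaban1985Variational, Thm 1 (8)–(9) p.279, Prop. 8 p.304; Balaban1989LargeFieldII, Thm 1 p.355 (bookkeeping)] -/
theorem h11F_ofHistoryBlind_theta13OfThm1CCMW_of_supplyChainAt
    (hNF : ∀ {j c : ℕ} {γ ε₀ ε₂₉ B₃ B₃' a₀ a₁ : ℝ} (_hγ₀ : 0 < γ) (_hγh : γ ≤ 1 / 2) (_hε : 0 < ε₀) (_hε' : 0 < ε₂₉) (_hB : 0 ≤ B₃) (_hB' : 0 ≤ B₃') (_ha₀ : 0 < a₀) (_ha₁ : 0 < a₁) (_h15 : VariationalThm1RegSepCoP7M F N B₃ a₀ a₁) (_hc : c ≤ F.L ^ j) (_h9 : Gauge9RegSepTopStepR F N (fun ν K Ω => suppDomOfRecord F ν K Ω) (F.L ^ j) c B₃ B₃' a₀ a₁) {bl β' : ℝ} (_hbox : BetaLowerH bl γ (betaOfRecord₁₃ F N (theta13OfThm1CCMW F N j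 γ ε₀ ε₂₉ B₃ B₃' a₀ a₁))) (_hbox' : BetaUpperH β' γ (betaOfRecord₁₃ F N (theta13OfThm1CCMW F N j γ ε₀ ε₂₉ B₃ B₃' a₀ a₁))) (_hl : -bl * γ ^ 2 ≤ 3) (_hβ' : β' * γ ^ 2 ≤ 3 / 4),
      ∀ P : B12.RunParams, SupplyChainAt (Stage13HParams.ofHistoryBlind F N ⟨theta13OfThm1CCMW F N j γ ε₀ ε₂₉ B₃ B₃' a₀ a₁, ZrOfRecord₁₃ F N (theta13OfThm1CCMW F N j γ ε₀ ε₂₉ B₃ B₃' a₀ a₁)⟩) P) :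
    ∀ {j c : ℕ} {γ ε₀ ε₂₉ B₃ B₃' a₀ a₁ : ℝ} (hγ₀ : 0 < γ) (hγh : γ ≤ 1 / 2) (hε : 0 < ε₀) (hε' : 0 < ε₂₉) (hB : 0 ≤ B₃) (hB' : 0 ≤ B₃') (ha₀ : 0 < a₀) (ha₁ : 0 < a₁) (h15 : VariationalThm1RegSepCoP7M F N B₃ a₀ a₁) (hc : c ≤ F.L ^ j) (h9 : Gauge9RegSepTopStepR F N (fun ν K Ω => suppDomOfRecord F ν K Ω) (F.L ^ j) c B₃ B₃' a₀ a₁) {bl β' : ℝ} (hbox : BetaLowerH bl γ (betaOfRecord₁₃ F N (theta13OfThm1CCMW F N j γ ε₀ ε₂₉ B₃ B₃' a₀ a₁))) (hbox' : BetaUpperH β' γ (betaOfRecord₁₃ F N (theta13OfThm1CCMW F N j γ ε₀ ε₂₉ B₃ B₃' a₀ a₁))) (hl : -bl * γ ^ 2 ≤ 3) (hβ' : β' * γ ^ 2 ≤ 3 / 4),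
      ∀ βup β₀ : ℝ, ∃ γ₁₁ : ℝ, 0 < γ₁₁ ∧ ∀ w : WorldP, w.C = (datumOfRecord₁₃SepCoPH F N (Stage13HParams.ofHistoryBlind F N ⟨theta13OfThm1CCMW F N j γ ε₀ ε₂₉ B₃ B₃' a₀ a₁, ZrOfRecord₁₃ F N (theta13OfThm1CCMW F N j γ ε₀ ε₂₉ B₃ B₃' a₀ a₁)⟩) (N24_provisos₁₃SepCoPH_door_theta13OfThm1CCMW_of_gauge9TopStepR_of_betaBoxSignFree_allTorus hγ₀ hγh hε hε' hB hB' ha₀ ha₁ h15 hc h9 hbox hbox' hl hβ')).C →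
      w.βup = βup → w.β₀ = β₀ → w.γ ≤ γ₁₁ → ∀ P : B12.RunParams, (leavesP w P).b7 → (leavesP w P).b8 → (leavesP w P).b9 → (leavesP w P).b10 → (leavesP w P).b11 →
      (leavesP w P).smallCouplings → (leavesP w P).smallFieldInductive → (leavesP w P).flowControl →
        ∀ k, k < P.K → SLaw₁₃CoPH F N (Stage13HParams.ofHistoryBlind F N ⟨theta13OfThm1CCMW F N j γ ε₀ ε₂₉ B₃ B₃' a₀ a₁, ZrOfRecord₁₃ F N (theta13OfThm1CCMW F N j γ ε₀ ε₂₉ B₃ B₃' a₀ a₁)⟩) P k → TLaw₁₃CoPH F N (Stage13HParams.ofHistoryBlind F N ⟨theta13OfThm1CCMW F N j γ ε₀ ε₂₉ B₃ B₃' a₀ a₁, ZrOfRecord₁₃ F N (theta13OfThm1CCMW F N j γ ε₀ ε₂₉ B₃ B₃' a₀ a₁)⟩) P k :=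
  by
  intro j c γ ε₀ ε₂₉ B₃ B₃' a₀ a₁ hγ₀ hγh hε hε' hB hB' ha₀ ha₁ h15 hc h9 bl β' hbox hbox' hl hβ'
  exact h11_ofHistoryBlind_theta13OfThm1CCMW_of_supplyChainAt hγ₀ hγh hε hε' hB hB' ha₀ ha₁ h15 hc h9 hbox hbox' hl hβ'
    (hNF hγ₀ hγh hε hε' hB hB' ha₀ ha₁ h15 hc h9 hbox hbox' hl hβ')

/-! ## §2  AS PRINTED: the TYPE `h11` through [III]'s sentence `B14.ThmP245PrintedI (T P) ρ S Scorr P.K` for an agreeing 𝐓-family, from a supplier per run -/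

/-- **★★ THE SPLIT CLOSERS' TYPE `h11` AT K1's WITNESS THROUGH [III]'s THEOREM OF p. 245 AS PRINTED**: for ANY family `T P k` of renormalization transformations on the runs' lattices
agreeing with the tower of record on the trajectory (`hTT : (T P k).T ρ_k = 𝐓ρ_k`, `k < K`), dag-n24-c 34H §2's AS-PRINTED door `N24_h11_theta13OfThm1CCMW_of_thmP245PrintedI` with its
binder `h245 : ∀ P, B14.ThmP245PrintedI (T P) (densOfRecord₁₃ θ₁₅ᶜᶜᴹᵂ P) S Scorr P.K` supplied BY NAME, per run, by dag-n11-e's `thmP245PrintedI_theta13OfThm1CCMWH_of_obligations`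
(R134 row N11∕s3) from `hrec := (door provisos).toCore`, a supplier `σ P` with `SupplierObligations` ([III] §3) and the `NoExpansionObligation` (dag-n11-d's clause).  LOCATED-ZH as
in §1 (the no-expansion obligation at the bare history-blind `θᴴ` is displayed, discharged by no lane).  CONDITIONAL; N11 NOT discharged; K1⁷ NOT closed.
[cite: Balaban1988Convergent, Theorem p.245, Thm 1 p.262, remark p.262, §3 p.279, (3.24)–(3.25) p.270; Balaban1987RG1, Thm 1 p.259; Balaban1989LargeFieldI, (0.2)–(0.4) p.176; Balaban1989LargeFieldII, Thm 1 p.355 (bookkeeping)] -/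
theorem h11_ofHistoryBlind_theta13OfThm1CCMW_of_thmP245PrintedI_of_obligations {j c : ℕ} {γ ε₀ ε₂₉ B₃ B₃' a₀ a₁ : ℝ} (hγ₀ : 0 < γ) (hγh : γ ≤ 1 / 2)
    (hε : 0 < ε₀) (hε' : 0 < ε₂₉) (hB : 0 ≤ B₃) (hB' : 0 ≤ B₃') (ha₀ : 0 < a₀) (ha₁ : 0 < a₁)
    (h15 : VariationalThm1RegSepCoP7M F N B₃ a₀ a₁) (hc : c ≤ F.L ^ j)
    (h9 : Gauge9RegSepTopStepR F N (fun ν K Ω => suppDomOfRecord F ν K Ω) (F.L ^ j) c B₃ B₃' a₀ a₁)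
    {bl β' : ℝ} (hbox : BetaLowerH bl γ (betaOfRecord₁₃ F N (theta13OfThm1CCMW F N j γ ε₀ ε₂₉ B₃ B₃' a₀ a₁)))
    (hbox' : BetaUpperH β' γ (betaOfRecord₁₃ F N (theta13OfThm1CCMW F N j γ ε₀ ε₂₉ B₃ B₃' a₀ a₁))) (hl : -bl * γ ^ 2 ≤ 3) (hβ' : β' * γ ^ 2 ≤ 3 / 4)
    (T : (P : B12.RunParams) → (k : ℕ) → RTOpI (F.P P.K) k (SU N) (avOfRecord F N P.K k))
    (hTT : ∀ (P : B12.RunParams) (k : ℕ), k < P.K → (T P k).T (densOfRecord₁₃ F N (theta13OfThm1CCMW F N j γ ε₀ ε₂₉ B₃ B₃' a₀ a₁) P k) = tdensOfRecord₁₃ F N (theta13OfThm1CCMW F N j γ ε₀ ε₂₉ B₃ B₃' a₀ a₁) P k)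
    (σ : (P : B12.RunParams) → Sect3Supplier (Stage13HParams.ofHistoryBlind F N ⟨theta13OfThm1CCMW F N j γ ε₀ ε₂₉ B₃ B₃' a₀ a₁, ZrOfRecord₁₃ F N (theta13OfThm1CCMW F N j γ ε₀ ε₂₉ B₃ B₃' a₀ a₁)⟩) P)
    (hσ : ∀ P, SupplierObligations (Stage13HParams.ofHistoryBlind F N ⟨theta13OfThm1CCMW F N j γ ε₀ ε₂₉ B₃ B₃' a₀ a₁, ZrOfRecord₁₃ F N (theta13OfThm1CCMW F N j γ ε₀ ε₂₉ B₃ B₃' a₀ a₁)⟩) P (σ P))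
    (hT : ∀ P, NoExpansionObligation (Stage13HParams.ofHistoryBlind F N ⟨theta13OfThm1CCMW F N j γ ε₀ ε₂₉ B₃ B₃' a₀ a₁, ZrOfRecord₁₃ F N (theta13OfThm1CCMW F N j γ ε₀ ε₂₉ B₃ B₃' a₀ a₁)⟩) P (σ P)) :
    ∀ βup β₀ : ℝ, ∃ γ₁₁ : ℝ, 0 < γ₁₁ ∧ ∀ w : WorldP, w.C = (datumOfRecord₁₃SepCoPH F N (Stage13HParams.ofHistoryBlind F N ⟨theta13OfThm1CCMW F N j γ ε₀ ε₂₉ B₃ B₃' a₀ a₁, ZrOfRecord₁₃ F N (theta13OfThm1CCMW F N j γ ε₀ ε₂₉ B₃ B₃' a₀ a₁)⟩) (N24_provisos₁₃SepCoPH_door_theta13OfThm1CCMW_of_gauge9TopStepR_of_betaBoxSignFree_allTorus hγ₀ hγh hε hε' hB hB' ha₀ ha₁ h15 hc h9 hbox hbox' hl hβ')).C →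
      w.βup = βup → w.β₀ = β₀ → w.γ ≤ γ₁₁ → ∀ P : B12.RunParams, (leavesP w P).b7 → (leavesP w P).b8 → (leavesP w P).b9 → (leavesP w P).b10 → (leavesP w P).b11 →
      (leavesP w P).smallCouplings → (leavesP w P).smallFieldInductive → (leavesP w P).flowControl →
        ∀ k, k < P.K → SLaw₁₃CoPH F N (Stage13HParams.ofHistoryBlind F N ⟨theta13OfThm1CCMW F N j γ ε₀ ε₂₉ B₃ B₃' a₀ a₁, ZrOfRecord₁₃ F N (theta13OfThm1CCMW F N j γ ε₀ ε₂₉ B₃ B₃' a₀ a₁)⟩) P k → TLaw₁₃CoPH F N (Stage13HParams.ofHistoryBlind F N ⟨theta13OfThm1CCMW F N j γ ε₀ ε₂₉ B₃ B₃' a₀ a₁, ZrOfRecord₁₃ F N (theta13OfThm1CCMW F N j γ ε₀ ε₂₉ B₃ B₃' a₀ a₁)⟩) P k :=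
  N24_h11_theta13OfThm1CCMW_of_thmP245PrintedI hγ₀ hγh hε hε' hB hB' ha₀ ha₁ h15 hc h9 hbox hbox' hl hβ' T hTT fun P =>
    thmP245PrintedI_theta13OfThm1CCMWH_of_obligations
      (θ := Stage13HParams.ofHistoryBlind F N ⟨theta13OfThm1CCMW F N j γ ε₀ ε₂₉ B₃ B₃' a₀ a₁, ZrOfRecord₁₃ F N (theta13OfThm1CCMW F N j γ ε₀ ε₂₉ B₃ B₃' a₀ a₁)⟩) rfl
      hγ₀ hγh hε hε' hB hB' ha₀ ha₁
      (N24_provisos₁₃SepCoPH_door_theta13OfThm1CCMW_of_gauge9TopStepR_of_betaBoxSignFree_allTorus hγ₀ hγh hε hε' hB hB' ha₀ ha₁ h15 hc h9 hbox hbox' hl hβ').toCore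
      (σ P) (hσ P) (hT P) (T P) (hTT P)

/-! ## §3  Rows: the TYPE `h11` and the FAMILY `h11F` from a supplier per run with its obligations, the witness-free residual rows and def-T's operand rows; `ZhUnity` discharged -/

/-- **★★ THE SPLIT CLOSERS' TYPE `h11` AT K1's WITNESS FROM A SUPPLIER PER RUN WITH ITS OBLIGATIONS AND THE ROWS** — dag-n24-c 34H §1 over dag-n11-e's
`thmP245Laws_all_ofHistoryBlind_theta13OfThm1CCMW_of_obligations_of_rows` (the no-expansion obligation DISCHARGED from the witness-free `ResidualRows` and def-T's
`OperandRowsAlongChain`, dag-n11-d's rows); `hrec := (door provisos).toCore`; the guard `θᴴ.ZhUnity` DISCHARGED in the kernel by def-T's `Stage13RParams.ZrUnity.ofHistoryBlind` over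
dag-n11-d's partition of unity `finsum_ζ0_ZrOfRecord₁₃` (dag-n24-c's door convention) — NOT displayed.  LOCATED-ZH: at the bare history-blind `θᴴ` the `ResidualRows` (the four pins
of the general step for the residual serving the no-expansion histories) are displayed, discharged by no lane off the diagonal.  CONDITIONAL; N11 NOT discharged; K1⁷ NOT closed.
[cite: Balaban1988Convergent, Theorem p.245, Thm 1 p.262, (3.24)–(3.25) p.270, (3.16)–(3.22) pp.268–269, (2.4)–(2.6) p.255; Balaban1987RG1, Thm 1 p.259; Balaban1989LargeFieldI, (0.2)–(0.4) p.176; Balaban1989LargeFieldII, Thm 1 p.355 (bookkeeping)] -/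
theorem h11_ofHistoryBlind_theta13OfThm1CCMW_of_obligations_of_rows {j c : ℕ} {γ ε₀ ε₂₉ B₃ B₃' a₀ a₁ : ℝ} (hγ₀ : 0 < γ) (hγh : γ ≤ 1 / 2)
    (hε : 0 < ε₀) (hε' : 0 < ε₂₉) (hB : 0 ≤ B₃) (hB' : 0 ≤ B₃') (ha₀ : 0 < a₀) (ha₁ : 0 < a₁)
    (h15 : VariationalThm1RegSepCoP7M F N B₃ a₀ a₁) (hc : c ≤ F.L ^ j)
    (h9 : Gauge9RegSepTopStepR F N (fun ν K Ω => suppDomOfRecord F ν K Ω) (F.L ^ j) c B₃ B₃' a₀ a₁)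
    {bl β' : ℝ} (hbox : BetaLowerH bl γ (betaOfRecord₁₃ F N (theta13OfThm1CCMW F N j γ ε₀ ε₂₉ B₃ B₃' a₀ a₁)))
    (hbox' : BetaUpperH β' γ (betaOfRecord₁₃ F N (theta13OfThm1CCMW F N j γ ε₀ ε₂₉ B₃ B₃' a₀ a₁))) (hl : -bl * γ ^ 2 ≤ 3) (hβ' : β' * γ ^ 2 ≤ 3 / 4)
    (σ : (P : B12.RunParams) → Sect3Supplier (Stage13HParams.ofHistoryBlind F N ⟨theta13OfThm1CCMW F N j γ ε₀ ε₂₉ B₃ B₃' a₀ a₁, ZrOfRecord₁₃ F N (theta13OfThm1CCMW F N j γ ε₀ ε₂₉ B₃ B₃' a₀ a₁)⟩) P)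
    (hσ : ∀ P, SupplierObligations (Stage13HParams.ofHistoryBlind F N ⟨theta13OfThm1CCMW F N j γ ε₀ ε₂₉ B₃ B₃' a₀ a₁, ZrOfRecord₁₃ F N (theta13OfThm1CCMW F N j γ ε₀ ε₂₉ B₃ B₃' a₀ a₁)⟩) P (σ P))
    (hres : ∀ P, ResidualRows (Stage13HParams.ofHistoryBlind F N ⟨theta13OfThm1CCMW F N j γ ε₀ ε₂₉ B₃ B₃' a₀ a₁, ZrOfRecord₁₃ F N (theta13OfThm1CCMW F N j γ ε₀ ε₂₉ B₃ B₃' a₀ a₁)⟩) P)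
    (hops : ∀ P, OperandRowsAlongChain (Stage13HParams.ofHistoryBlind F N ⟨theta13OfThm1CCMW F N j γ ε₀ ε₂₉ B₃ B₃' a₀ a₁, ZrOfRecord₁₃ F N (theta13OfThm1CCMW F N j γ ε₀ ε₂₉ B₃ B₃' a₀ a₁)⟩) P (σ P)) :
    ∀ βup β₀ : ℝ, ∃ γ₁₁ : ℝ, 0 < γ₁₁ ∧ ∀ w : WorldP, w.C = (datumOfRecord₁₃SepCoPH F N (Stage13HParams.ofHistoryBlind F N ⟨theta13OfThm1CCMW F N j γ ε₀ ε₂₉ B₃ B₃' a₀ a₁, ZrOfRecord₁₃ F N (theta13OfThm1CCMW F N j γ ε₀ ε₂₉ B₃ B₃' a₀ a₁)⟩) (N24_provisos₁₃SepCoPH_door_theta13OfThm1CCMW_of_gauge9TopStepR_of_betaBoxSignFree_allTorus hγ₀ hγh hε hε' hB hB' ha₀ ha₁ h15 hc h9 hbox hbox' hl hβ')).C →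
      w.βup = βup → w.β₀ = β₀ → w.γ ≤ γ₁₁ → ∀ P : B12.RunParams, (leavesP w P).b7 → (leavesP w P).b8 → (leavesP w P).b9 → (leavesP w P).b10 → (leavesP w P).b11 →
      (leavesP w P).smallCouplings → (leavesP w P).smallFieldInductive → (leavesP w P).flowControl →
        ∀ k, k < P.K → SLaw₁₃CoPH F N (Stage13HParams.ofHistoryBlind F N ⟨theta13OfThm1CCMW F N j γ ε₀ ε₂₉ B₃ B₃' a₀ a₁, ZrOfRecord₁₃ F N (theta13OfThm1CCMW F N j γ ε₀ ε₂₉ B₃ B₃' a₀ a₁)⟩) P k → TLaw₁₃CoPH F N (Stage13HParams.ofHistoryBlind F N ⟨theta13OfThm1CCMW F N j γ ε₀ ε₂₉ B₃ B₃' a₀ a₁, ZrOfRecord₁₃ F N (theta13OfThm1CCMW F N j γ ε₀ ε₂₉ B₃ B₃' a₀ a₁)⟩) P k :=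
  N24_h11_theta13OfThm1CCMW_of_thmP245_laws hγ₀ hγh hε hε' hB hB' ha₀ ha₁ h15 hc h9 hbox hbox' hl hβ'
    (thmP245Laws_all_ofHistoryBlind_theta13OfThm1CCMW_of_obligations_of_rows (ZrOfRecord₁₃ F N (theta13OfThm1CCMW F N j γ ε₀ ε₂₉ B₃ B₃' a₀ a₁)) hγ₀ hγh hε hε' hB hB' ha₀ ha₁
      (N24_provisos₁₃SepCoPH_door_theta13OfThm1CCMW_of_gauge9TopStepR_of_betaBoxSignFree_allTorus hγ₀ hγh hε hε' hB hB' ha₀ ha₁ h15 hc h9 hbox hbox' hl hβ').toCore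
      (Stage13RParams.ZrUnity.ofHistoryBlind (θ := ⟨theta13OfThm1CCMW F N j γ ε₀ ε₂₉ B₃ B₃' a₀ a₁, ZrOfRecord₁₃ F N (theta13OfThm1CCMW F N j γ ε₀ ε₂₉ B₃ B₃' a₀ a₁)⟩)
        fun p i ω => finsum_ζ0_ZrOfRecord₁₃ (θ := theta13OfThm1CCMW F N j γ ε₀ ε₂₉ B₃ B₃' a₀ a₁) (p := p) i ω)
      σ hσ hres hops)

/-- **★★ THE SPLIT CLOSERS' WORLD-FREE FAMILY `h11F` VERBATIM FROM A FAMILY OF SUPPLIERS WITH OBLIGATIONS AND ROWS** — §3's first theorem under the binders: the family hypothesis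
`hRF` delivers, for all door letters and hypotheses and every run `P`, SOME supplier `σ` with `SupplierObligations ∧ ResidualRows ∧ OperandRowsAlongChain` at the bare `θᴴ`;
`ZhUnity` discharged as in §3's first theorem.  LOCATED-ZH as there.  CONDITIONAL; N11 NOT discharged; K1⁷ NOT closed.
[cite: Balaban1988Convergent, Theorem p.245, Thm 1 p.262, (3.24)–(3.25) p.270, (3.16)–(3.22) pp.268–269, (2.4)–(2.6) p.255; Balaban1987RG1, Thm 1 p.259; Balaban1989LargeFieldI, (0.2)–(0.4) p.176; Balaban1985Variational, Thm 1 (8)–(9) p.279, Prop. 8 p.304; Balaban1989LargeFieldII, Thm 1 p.355 (bookkeeping)] -/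
theorem h11F_ofHistoryBlind_theta13OfThm1CCMW_of_obligations_of_rows
    (hRF : ∀ {j c : ℕ} {γ ε₀ ε₂₉ B₃ B₃' a₀ a₁ : ℝ} (_hγ₀ : 0 < γ) (_hγh : γ ≤ 1 / 2) (_hε : 0 < ε₀) (_hε' : 0 < ε₂₉) (_hB : 0 ≤ B₃) (_hB' : 0 ≤ B₃') (_ha₀ : 0 < a₀) (_ha₁ : 0 < a₁) (_h15 : VariationalThm1RegSepCoP7M F N B₃ a₀ a₁) (_hc : c ≤ F.L ^ j) (_h9 : Gauge9RegSepTopStepR F N (fun ν K Ω => suppDomOfRecord F ν K Ω) (F.L ^ j) c B₃ B₃' a₀ a₁) {bl β' : ℝ} (_hbox : BetaLowerH bl γ (betaOfRecord₁₃ F N (theta13OfThm1CCMW F N j γ ε₀ ε₂₉ B₃ B₃' a₀ a₁))) (_hbox' : BetaUpperH β' γ (betaOfRecord₁₃ F N (theta13OfThm1CCMW F N j γ ε₀ ε₂₉ B₃ B₃' a₀ a₁))) (_hl : -bl * γ ^ 2 ≤ 3) (_hβ' : β' * γ ^ 2 ≤ 3 / 4),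
      ∀ P : B12.RunParams, ∃ σ : Sect3Supplier (Stage13HParams.ofHistoryBlind F N ⟨theta13OfThm1CCMW F N j γ ε₀ ε₂₉ B₃ B₃' a₀ a₁, ZrOfRecord₁₃ F N (theta13OfThm1CCMW F N j γ ε₀ ε₂₉ B₃ B₃' a₀ a₁)⟩) P,
        SupplierObligations (Stage13HParams.ofHistoryBlind F N ⟨theta13OfThm1CCMW F N j γ ε₀ ε₂₉ B₃ B₃' a₀ a₁, ZrOfRecord₁₃ F N (theta13OfThm1CCMW F N j γ ε₀ ε₂₉ B₃ B₃' a₀ a₁)⟩) P σ ∧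
        ResidualRows (Stage13HParams.ofHistoryBlind F N ⟨theta13OfThm1CCMW F N j γ ε₀ ε₂₉ B₃ B₃' a₀ a₁, ZrOfRecord₁₃ F N (theta13OfThm1CCMW F N j γ ε₀ ε₂₉ B₃ B₃' a₀ a₁)⟩) P ∧
        OperandRowsAlongChain (Stage13HParams.ofHistoryBlind F N ⟨theta13OfThm1CCMW F N j γ ε₀ ε₂₉ B₃ B₃' a₀ a₁, ZrOfRecord₁₃ F N (theta13OfThm1CCMW F N j γ ε₀ ε₂₉ B₃ B₃' a₀ a₁)⟩) P σ) :
    ∀ {j c : ℕ} {γ ε₀ ε₂₉ B₃ B₃' a₀ a₁ : ℝ} (hγ₀ : 0 < γ) (hγh : γ ≤ 1 / 2) (hε : 0 < ε₀) (hε' : 0 < ε₂₉) (hB : 0 ≤ B₃) (hB' : 0 ≤ B₃') (ha₀ : 0 < a₀) (ha₁ : 0 < a₁) (h15 : VariationalThm1RegSepCoP7M F N B₃ a₀ a₁) (hc : c ≤ F.L ^ j) (h9 : Gauge9RegSepTopStepR F N (fun ν K Ω => suppDomOfRecord F ν K Ω) (F.L ^ j) c B₃ B₃' a₀ a₁) {bl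 β' : ℝ} (hbox : BetaLowerH bl γ (betaOfRecord₁₃ F N (theta13OfThm1CCMW F N j γ ε₀ ε₂₉ B₃ B₃' a₀ a₁))) (hbox' : BetaUpperH β' γ (betaOfRecord₁₃ F N (theta13OfThm1CCMW F N j γ ε₀ ε₂₉ B₃ B₃' a₀ a₁))) (hl : -bl * γ ^ 2 ≤ 3) (hβ' : β' * γ ^ 2 ≤ 3 / 4),
      ∀ βup β₀ : ℝ, ∃ γ₁₁ : ℝ, 0 < γ₁₁ ∧ ∀ w : WorldP, w.C = (datumOfRecord₁₃SepCoPH F N (Stage13HParams.ofHistoryBlind F N ⟨theta13OfThm1CCMW F N j γ ε₀ ε₂₉ B₃ B₃' a₀ a₁, ZrOfRecord₁₃ F N (theta13OfThm1CCMW F N j γ ε₀ ε₂₉ B₃ B₃' a₀ a₁)⟩) (N24_provisos₁₃SepCoPH_door_theta13OfThm1CCMW_of_gauge9TopStepR_of_betaBoxSignFree_allTorus hγ₀ hγh hε hε' hB hB' ha₀ ha₁ h15 hc h9 hbox hbox' hl hβ')).C →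
      w.βup = βup → w.β₀ = β₀ → w.γ ≤ γ₁₁ → ∀ P : B12.RunParams, (leavesP w P).b7 → (leavesP w P).b8 → (leavesP w P).b9 → (leavesP w P).b10 → (leavesP w P).b11 →
      (leavesP w P).smallCouplings → (leavesP w P).smallFieldInductive → (leavesP w P).flowControl →
        ∀ k, k < P.K → SLaw₁₃CoPH F N (Stage13HParams.ofHistoryBlind F N ⟨theta13OfThm1CCMW F N j γ ε₀ ε₂₉ B₃ B₃' a₀ a₁, ZrOfRecord₁₃ F N (theta13OfThm1CCMW F N j γ ε₀ ε₂₉ B₃ B₃' a₀ a₁)⟩) P k → TLaw₁₃CoPH F N (Stage13HParams.ofHistoryBlind F N ⟨theta13OfThm1CCMW F N j γ ε₀ ε₂₉ B₃ B₃' a₀ a₁, ZrOfRecord₁₃ F N (theta13OfThm1CCMW F N j γ ε₀ ε₂₉ B₃ B₃' a₀ a₁)⟩) P k :=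
  by
  intro j c γ ε₀ ε₂₉ B₃ B₃' a₀ a₁ hγ₀ hγh hε hε' hB hB' ha₀ ha₁ h15 hc h9 bl β' hbox hbox' hl hβ'
  exact h11_ofHistoryBlind_theta13OfThm1CCMW_of_obligations_of_rows hγ₀ hγh hε hε' hB hB' ha₀ ha₁ h15 hc h9 hbox hbox' hl hβ'
    (fun P => (hRF hγ₀ hγh hε hε' hB hB' ha₀ ha₁ h15 hc h9 hbox hbox' hl hβ' P).choose)
    (fun P => (hRF hγ₀ hγh hε hε' hB hB' ha₀ ha₁ h15 hc h9 hbox hbox' hl hβ' P).choose_spec.1)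
    (fun P => (hRF hγ₀ hγh hε hε' hB hB' ha₀ ha₁ h15 hc h9 hbox hbox' hl hβ' P).choose_spec.2.1)
    (fun P => (hRF hγ₀ hγh hε hε' hB hB' ha₀ ha₁ h15 hc h9 hbox hbox' hl hβ' P).choose_spec.2.2)

end Summit.QuantumFields.YangMills.Theorems.BalabanUVNodesN11H11TypeOfSupplyChain

end
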